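import Summits.CriticalPhenomena.PercolationContinuityZ3.Theorems.PercNearOneGluingNoHeavyLowerTailUpwardTransportSingletonsRows
import HarnessLib

/-!
# `NoHeavyLowerTail` (stmt-CriticalPhenomena-4575) — UT for singleton pockets, part 2: target step and packing

Lemma factory #6 (`prim-lf-6`, gen 2).  Continuation of `…UpwardTransportSingletonsRows.lean`:

* `targetStep_upset` — `μ(E ∩ M) · μ(J_T ∩ D_T) ≤ μ(M) · μ(E ∩ (J_T ∩ D_T))` for `E = {o ↔ T} ∩ {C_T ∈ 𝒰}`
  (BHK 2006 Thm 1.3 for the set `T`, twice);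
* `packing_upset_of_pos`, `packing_upset` — the ratio packing of the singleton sources `x ∈ T' ⊆ T` into the joined target
  block `T` with the up-set carried along: `(Σ_x μ({o↔x} ∩ {C_x∈𝒰} ∩ D_x ∩ {N_c ≥ j+1}) / t_x) · μ(J_T ∩ D_T) ≤
  μ({o↔T} ∩ {C_o∈𝒰} ∩ (J_T ∩ D_T))` (source steps, disjointness under `M` with `C_x ∈ 𝒰 ⇒ C_T ∈ 𝒰`, target step, and on
  `{o ↔ T} ∩ J_T` the identity `C_T = C_o`); the glued case `μ(M) = 0` is removed by scaling the weights
  (`stub_weightContinuity`), as in `LevelPacking.levelPackingRatio`.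

No definitions, no named facts, no sorries.
-/

noncomputable section

namespace Summit.CriticalPhenomena.PercolationContinuityZ3.Theorems

open scoped BigOperators Classical Topology
open MeasureTheory Set Filter
open Literature.Probability.LatticeModels (prodBernoulli)
open Literature.Probability.Percolation
open BlockLonelyRelay GuardedBlockLonelyRelay AttachedChampionLevelOne LonelyObserver

variable {n : ℕ}

namespace UTSingletons

/-- **Target step with an up-set.**  `D_T = {T ↮ A∖T}`, `J_T` = `T` pairwise joined, `M = D_T ∩ {T pairwise separated}`,
`E = {o ↔ T} ∩ {C_T ∈ 𝒰}`:  `μ(E ∩ M) · μ(J_T ∩ D_T) ≤ μ(M) · μ(E ∩ (J_T ∩ D_T))` — BHK Thm 1.3 for the set `T` twice.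
[cite: VandenbergHaggstromKahn2005, Thm. 1.3 with Remark 1 (p. 5)] -/
theorem targetStep_upset (w : Sym2 (Fin n) → unitInterval) (A T : Finset (Fin n)) (o : Fin n)
    (U : Set (Set (Sym2 (Fin n)))) (hU : IsUpperSet U) :
    (prodBernoulli w).real (({ω | ∃ t ∈ T, ω ∈ openConn o t} ∩
          {ω | (⋃ s ∈ (↑T : Set (Fin n)), openEdgeCluster ω s) ∈ U}) ∩
        ({ω | ∀ s ∈ T, ∀ t ∈ A \ T, ω ∉ openConn s t} ∩ {ω | ∀ t ∈ T, ∀ t' ∈ T, t ≠ t' → ω ∉ openConn t t'})) *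
      (prodBernoulli w).real ({ω | ∀ t ∈ T, ∀ t' ∈ T, ω ∈ openConn t t'} ∩
        {ω | ∀ s ∈ T, ∀ t ∈ A \ T, ω ∉ openConn s t}) ≤
    (prodBernoulli w).real ({ω | ∀ s ∈ T, ∀ t ∈ A \ T, ω ∉ openConn s t} ∩
          {ω | ∀ t ∈ T, ∀ t' ∈ T, t ≠ t' → ω ∉ openConn t t'}) *
      (prodBernoulli w).real (({ω | ∃ t ∈ T, ω ∈ openConn o t} ∩
          {ω | (⋃ s ∈ (↑T : Set (Fin n)), openEdgeCluster ω s) ∈ U}) ∩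
        ({ω | ∀ t ∈ T, ∀ t' ∈ T, ω ∈ openConn t t'} ∩ {ω | ∀ s ∈ T, ∀ t ∈ A \ T, ω ∉ openConn s t})) := by
  set μ := prodBernoulli w with hμ
  set P : Set (Sym2 (Fin n)) → Prop := fun C =>
    (o ∈ (↑T : Set (Fin n)) ∨ ∃ e ∈ C, o ∈ e) ∧ C ∈ U with hP
  set J : Set (Sym2 (Fin n)) → Prop := fun C =>
    ∀ t ∈ T, ∀ t' ∈ T, (SimpleGraph.fromEdgeSet C).Reachable t t' with hJ
  set PC : Set (Sym2 (Fin n)) → Prop := fun C =>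
    ∃ s ∈ (↑T : Set (Fin n)), ∃ s' ∈ (↑T : Set (Fin n)), s ≠ s' ∧ (SimpleGraph.fromEdgeSet C).Reachable s s'
    with hPC
  have hPm : ∀ ⦃C C' : Set (Sym2 (Fin n))⦄, C ⊆ C' → P C → P C' := joinUp_mono _ o hU
  have hJm : ∀ ⦃C C' : Set (Sym2 (Fin n))⦄, C ⊆ C' → J C → J C' := LevelPacking.allConn_mono T
  have hPCm : ∀ ⦃C C' : Set (Sym2 (Fin n))⦄, C ⊆ C' → PC C → PC C' := pairConn_mono (↑T : Set (Fin n))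
  set D : Set (BondConfig (Fin n)) := {ω | ∀ s ∈ T, ∀ t ∈ A \ T, ω ∉ openConn s t} with hD
  set EP : Set (BondConfig (Fin n)) := {ω | P (⋃ s ∈ (↑T : Set (Fin n)), openEdgeCluster ω s)} with hEP
  set EJ : Set (BondConfig (Fin n)) := {ω | J (⋃ s ∈ (↑T : Set (Fin n)), openEdgeCluster ω s)} with hEJ
  set EPC : Set (BondConfig (Fin n)) := {ω | PC (⋃ s ∈ (↑T : Set (Fin n)), openEdgeCluster ω s)} with hEPC
  have h1 : μ.real D * μ.real (D ∩ (EP ∩ {ω | ¬ PC (⋃ s ∈ (↑T : Set (Fin n)), openEdgeCluster ω s)})) ≤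
      μ.real (D ∩ EP) * μ.real (D ∩ {ω | ¬ PC (⋃ s ∈ (↑T : Set (Fin n)), openEdgeCluster ω s)}) :=
    negAssoc_pred_compl w T (A \ T) P PC hPm hPCm
  have h2 : μ.real (D ∩ EP) * μ.real (D ∩ EJ) ≤ μ.real D * μ.real (D ∩ (EP ∩ EJ)) :=
    posAssoc_pred w T (A \ T) P J hPm hJm
  -- identifications
  have hEP_eq : EP = {ω | ∃ t ∈ T, ω ∈ openConn o t} ∩
      {ω | (⋃ s ∈ (↑T : Set (Fin n)), openEdgeCluster ω s) ∈ U} := joinUp_set_eq T o U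
  have hEJ_eq : EJ = {ω | ∀ t ∈ T, ∀ t' ∈ T, ω ∈ openConn t t'} := allConn_eq T
  have hM_eq : D ∩ {ω | ¬ PC (⋃ s ∈ (↑T : Set (Fin n)), openEdgeCluster ω s)} =
      D ∩ {ω | ∀ t ∈ T, ∀ t' ∈ T, t ≠ t' → ω ∉ openConn t t'} := DT_inter_not_pairConn_eq A T
  have ea : ({ω | ∃ t ∈ T, ω ∈ openConn o t} ∩ {ω | (⋃ s ∈ (↑T : Set (Fin n)), openEdgeCluster ω s) ∈ U}) ∩
      (D ∩ {ω | ∀ t ∈ T, ∀ t' ∈ T, t ≠ t' → ω ∉ openConn t t'}) =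
      D ∩ (EP ∩ {ω | ¬ PC (⋃ s ∈ (↑T : Set (Fin n)), openEdgeCluster ω s)}) := by
    ext ω
    constructor
    · rintro ⟨hE, hDS⟩
      have hE' : ω ∈ EP := by rw [hEP_eq]; exact hE
      have hDS' : ω ∈ D ∩ {ω | ¬ PC (⋃ s ∈ (↑T : Set (Fin n)), openEdgeCluster ω s)} := by
        rw [hM_eq]; exact hDS
      exact ⟨hDS'.1, hE', hDS'.2⟩
    · rintro ⟨hDω, hE', hnc⟩
      have hE : ω ∈ {ω | ∃ t ∈ T, ω ∈ openConn o t} ∩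
          {ω | (⋃ s ∈ (↑T : Set (Fin n)), openEdgeCluster ω s) ∈ U} := by rw [← hEP_eq]; exact hE'
      have hDS : ω ∈ D ∩ {ω | ∀ t ∈ T, ∀ t' ∈ T, t ≠ t' → ω ∉ openConn t t'} := by
        rw [← hM_eq]; exact ⟨hDω, hnc⟩
      exact ⟨hE, hDS⟩
  have eg : ({ω | ∃ t ∈ T, ω ∈ openConn o t} ∩ {ω | (⋃ s ∈ (↑T : Set (Fin n)), openEdgeCluster ω s) ∈ U}) ∩
      ({ω | ∀ t ∈ T, ∀ t' ∈ T, ω ∈ openConn t t'} ∩ D) = D ∩ (EP ∩ EJ) := by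
    ext ω
    constructor
    · rintro ⟨hE, hJ, hDω⟩
      have hE' : ω ∈ EP := by rw [hEP_eq]; exact hE
      have hJ' : ω ∈ EJ := by rw [hEJ_eq]; exact hJ
      exact ⟨hDω, hE', hJ'⟩
    · rintro ⟨hDω, hE', hJ'⟩
      have hE : ω ∈ {ω | ∃ t ∈ T, ω ∈ openConn o t} ∩
          {ω | (⋃ s ∈ (↑T : Set (Fin n)), openEdgeCluster ω s) ∈ U} := by rw [← hEP_eq]; exact hE'
      have hJ : ω ∈ {ω | ∀ t ∈ T, ∀ t' ∈ T, ω ∈ openConn t t'} := by rw [← hEJ_eq]; exact hJ'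
      exact ⟨hE, hJ, hDω⟩
  have eh : {ω | ∀ t ∈ T, ∀ t' ∈ T, ω ∈ openConn t t'} ∩ D = D ∩ EJ := by rw [← hEJ_eq, inter_comm]
  rw [ea, eg, eh, ← hM_eq]
  -- arithmetic: μ(D)·a ≤ e·m and e·h ≤ μ(D)·g ⟹ a·h ≤ m·g
  set d := μ.real D
  set a := μ.real (D ∩ (EP ∩ {ω | ¬ PC (⋃ s ∈ (↑T : Set (Fin n)), openEdgeCluster ω s)}))
  set e := μ.real (D ∩ EP)
  set m := μ.real (D ∩ {ω | ¬ PC (⋃ s ∈ (↑T : Set (Fin n)), openEdgeCluster ω s)})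
  set h := μ.real (D ∩ EJ)
  set g := μ.real (D ∩ (EP ∩ EJ))
  have ha0 : 0 ≤ a := measureReal_nonneg
  have hm0 : 0 ≤ m := measureReal_nonneg
  have hh0 : 0 ≤ h := measureReal_nonneg
  have hg0 : 0 ≤ g := measureReal_nonneg
  have had : a ≤ d := measureReal_mono (fun ω hω => hω.1) (measure_ne_top _ _)
  rcases (measureReal_nonneg : 0 ≤ d).eq_or_lt with hd0 | hdpos
  · have ha' : a = 0 := le_antisymm (hd0 ▸ had) ha0
    rw [ha', zero_mul]; exact mul_nonneg hm0 hg0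
  · have h3 : d * (a * h) ≤ d * (m * g) := by
      calc d * (a * h) = (d * a) * h := by ring
        _ ≤ (e * m) * h := mul_le_mul_of_nonneg_right h1 hh0
        _ = m * (e * h) := by ring
        _ ≤ m * (d * g) := mul_le_mul_of_nonneg_left h2 hm0
        _ = d * (m * g) := by ring
    exact le_of_mul_le_mul_left h3 hdpos

/-- On `{o ↔ T} ∩ {T pairwise joined}` the union cluster `C_T` is the observer's cluster `C_o`. [folklore] -/
theorem biUnion_eq_openEdgeCluster_of_joined {T : Finset (Fin n)} {o : Fin n} {ω : BondConfig (Fin n)}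
    (hE : ∃ t ∈ T, ω ∈ openConn o t) (hJ : ∀ t ∈ T, ∀ t' ∈ T, ω ∈ openConn t t') :
    (⋃ s ∈ (↑T : Set (Fin n)), openEdgeCluster ω s) = openEdgeCluster ω o := by
  obtain ⟨t₀, ht₀, hot₀⟩ := hE
  apply subset_antisymm
  · intro e he
    obtain ⟨s, hs, hes⟩ := mem_iUnion₂.1 he
    have hos : ω ∈ (openConn o s : Set (BondConfig (Fin n))) :=
      ((hot₀ : (openGraph ω).Reachable o t₀).trans (hJ t₀ ht₀ s hs : (openGraph ω).Reachable t₀ s))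
    rwa [exS1_openEdgeCluster_eq_of_conn hos]
  · intro e he
    exact mem_iUnion₂.2 ⟨t₀, Finset.mem_coe.2 ht₀, by rwa [← exS1_openEdgeCluster_eq_of_conn hot₀]⟩

/-- **Packing of the singleton sources with an up-set, when `μ(M) > 0`.**  For `T ⊆ A`, `c ∈ A ∖ T`, an up-set `𝒰`,
per-source bounds `μ(D_x ∩ {N_c ≥ j+1}) ≤ t_x` (`0 ≤ t_x`):
`(Σ_{x ∈ T} μ({o↔x} ∩ {C_x ∈ 𝒰} ∩ D_x ∩ {N_c ≥ j+1}) / t_x) · μ(J_T ∩ D_T) ≤ μ({o ↔ T} ∩ {C_o ∈ 𝒰} ∩ (J_T ∩ D_T))`.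
[cite: KozmaNitzan2024, Lemmas 1–2 (pp. 5–6); VandenbergHaggstromKahn2005, Thms. 1.3, 1.5] -/
theorem packing_upset_of_pos (w : Sym2 (Fin n) → unitInterval) (A T : Finset (Fin n)) (hTA : T ⊆ A)
    (o c : Fin n) (j : ℕ) (hc : c ∈ A \ T) (U : Set (Set (Sym2 (Fin n)))) (hU : IsUpperSet U)
    (T' : Finset (Fin n)) (hT' : T' ⊆ T) (t : Fin n → ℝ) (ht : ∀ x ∈ T', 0 ≤ t x)
    (hq : ∀ x ∈ T', (prodBernoulli w).real ({ω | ∀ s ∈ ({x} : Finset (Fin n)), ∀ u ∈ A \ {x}, ω ∉ openConn s u} ∩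
      {ω | j + 1 ≤ (A.filter fun z => ω ∈ openConn c z).card}) ≤ t x)
    (hM : 0 < (prodBernoulli w).real {ω : BondConfig (Fin n) | ∀ y ∈ T, ∀ a ∈ A, y ≠ a → ω ∉ openConn y a}) :
    (∑ x ∈ T', (prodBernoulli w).real ((openConn o x : Set (BondConfig (Fin n))) ∩ {ω | openEdgeCluster ω x ∈ U} ∩
        {ω | ∀ s ∈ ({x} : Finset (Fin n)), ∀ u ∈ A \ {x}, ω ∉ openConn s u} ∩
        {ω | j + 1 ≤ (A.filter fun z => ω ∈ openConn c z).card}) / t x) *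
      (prodBernoulli w).real ({ω | ∀ t ∈ T, ∀ t' ∈ T, ω ∈ openConn t t'} ∩
        {ω | ∀ s ∈ T, ∀ u ∈ A \ T, ω ∉ openConn s u}) ≤
    (prodBernoulli w).real (({ω | ∃ t ∈ T, ω ∈ openConn o t} ∩ {ω | openEdgeCluster ω o ∈ U}) ∩
      ({ω | ∀ t ∈ T, ∀ t' ∈ T, ω ∈ openConn t t'} ∩ {ω | ∀ s ∈ T, ∀ u ∈ A \ T, ω ∉ openConn s u})) := by
  set μ := prodBernoulli w with hμ
  have hmeas : ∀ s : Set (BondConfig (Fin n)), MeasurableSet s := fun _ => MeasurableSet.of_discrete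
  obtain ⟨hcA, hcT⟩ := Finset.mem_sdiff.1 hc
  set M : Set (BondConfig (Fin n)) := {ω | ∀ y ∈ T, ∀ a ∈ A, y ≠ a → ω ∉ openConn y a} with hMdef
  set src : Fin n → Set (BondConfig (Fin n)) := fun x =>
    (openConn o x : Set (BondConfig (Fin n))) ∩ {ω | openEdgeCluster ω x ∈ U} ∩
      {ω | ∀ s ∈ ({x} : Finset (Fin n)), ∀ u ∈ A \ {x}, ω ∉ openConn s u} ∩
      {ω | j + 1 ≤ (A.filter fun z => ω ∈ openConn c z).card} with hsrc
  set EU : Fin n → Set (BondConfig (Fin n)) := fun x =>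
    (openConn o x : Set (BondConfig (Fin n))) ∩ {ω | openEdgeCluster ω x ∈ U} with hEU
  set ET : Set (BondConfig (Fin n)) := {ω | ∃ t ∈ T, ω ∈ openConn o t} ∩
    {ω | (⋃ s ∈ (↑T : Set (Fin n)), openEdgeCluster ω s) ∈ U} with hET
  set JD : Set (BondConfig (Fin n)) := {ω | ∀ t ∈ T, ∀ t' ∈ T, ω ∈ openConn t t'} ∩
    {ω | ∀ s ∈ T, ∀ u ∈ A \ T, ω ∉ openConn s u} with hJD
  -- `M = D_T ∩ Sep_T`
  have hM_eq : M = {ω | ∀ s ∈ T, ∀ u ∈ A \ T, ω ∉ openConn s u} ∩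
      {ω | ∀ t ∈ T, ∀ t' ∈ T, t ≠ t' → ω ∉ openConn t t'} := by
    ext ω
    simp only [hMdef, mem_setOf_eq, mem_inter_iff, Finset.mem_sdiff]
    constructor
    · intro h
      exact ⟨fun s hs u hu => h s hs u hu.1 (fun e => hu.2 (e ▸ hs)), fun t ht t' ht' hne => h t ht t' (hTA ht') hne⟩
    · rintro ⟨h1, h2⟩ y hy a ha hya
      by_cases haT : a ∈ T
      · exact h2 y hy a haT hya
      · exact h1 y hy a ⟨ha, haT⟩
  -- (1) source steps: `μ(src x) · μ(M) ≤ t_x · μ(EU x ∩ M)`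
  have hstep : ∀ x ∈ T', μ.real (src x) * μ.real M ≤ t x * μ.real (EU x ∩ M) := by
    intro x hx
    have hxc : x ≠ c := fun h => hcT (h ▸ hT' hx)
    have key := sourceStep_upset w A T hTA o c j hcA (hT' hx) hxc U hU
    refine key.trans ?_
    exact mul_le_mul_of_nonneg_right (hq x hx) measureReal_nonneg
  -- (2) the `EU x ∩ M` are pairwise disjoint and lie in `ET ∩ M`
  have hdisj : (↑T' : Set (Fin n)).PairwiseDisjoint fun x => EU x ∩ M := by
    intro x hx x' hx' hne
    rw [Function.onFun, disjoint_left]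
    intro ω hω hω'
    have h1 : (openGraph ω).Reachable o x := hω.1.1
    have h2 : (openGraph ω).Reachable o x' := hω'.1.1
    exact hω.2 x (hT' hx) x' (hTA (hT' hx')) hne (h1.symm.trans h2)
  have hsubET : ∀ x ∈ T', EU x ∩ M ⊆ ET ∩ M := by
    intro x hx ω hω
    obtain ⟨⟨hox, hU'⟩, hωM⟩ := hω
    refine ⟨⟨⟨x, hT' hx, hox⟩, ?_⟩, hωM⟩
    exact hU (subset_biUnion_of_mem (u := fun s => openEdgeCluster ω s) (Finset.mem_coe.2 (hT' hx))) hU'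
  have hsum : ∑ x ∈ T', μ.real (EU x ∩ M) ≤ μ.real (ET ∩ M) := by
    rw [← measureReal_biUnion_finset hdisj fun x _ => hmeas _]
    exact measureReal_mono (iUnion₂_subset fun x hx => hsubET x hx) (measure_ne_top _ _)
  -- (3) target step
  have htgt : μ.real (ET ∩ M) * μ.real JD ≤ μ.real M * μ.real (ET ∩ JD) := by
    have key := targetStep_upset w A T o U hU
    rw [← hM_eq] at key
    exact key
  -- (4) assembly
  have hdiv : ∀ x ∈ T', μ.real (src x) / t x ≤ μ.real (EU x ∩ M) / μ.real M := by
    intro x hx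
    rcases (ht x hx).eq_or_lt with h0 | hpos
    · rw [← h0, div_zero]; exact div_nonneg measureReal_nonneg measureReal_nonneg
    · rw [div_le_div_iff₀ hpos hM]
      calc μ.real (src x) * μ.real M ≤ t x * μ.real (EU x ∩ M) := hstep x hx
        _ = μ.real (EU x ∩ M) * t x := mul_comm _ _
  have hS : ∑ x ∈ T', μ.real (src x) / t x ≤ μ.real (ET ∩ M) / μ.real M := by
    calc ∑ x ∈ T', μ.real (src x) / t x ≤ ∑ x ∈ T', μ.real (EU x ∩ M) / μ.real M := Finset.sum_le_sum hdiv
      _ = (∑ x ∈ T', μ.real (EU x ∩ M)) / μ.real M := by rw [Finset.sum_div]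
      _ ≤ μ.real (ET ∩ M) / μ.real M := div_le_div_of_nonneg_right hsum hM.le
  have hfin : (∑ x ∈ T', μ.real (src x) / t x) * μ.real JD ≤ μ.real (ET ∩ JD) := by
    calc (∑ x ∈ T', μ.real (src x) / t x) * μ.real JD ≤ μ.real (ET ∩ M) / μ.real M * μ.real JD :=
          mul_le_mul_of_nonneg_right hS measureReal_nonneg
      _ = μ.real (ET ∩ M) * μ.real JD / μ.real M := by ring
      _ ≤ μ.real M * μ.real (ET ∩ JD) / μ.real M := div_le_div_of_nonneg_right htgt hM.le
      _ = μ.real (ET ∩ JD) := by field_simp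
  -- (5) on `ET ∩ JD` the union cluster is `C_o`
  have hET_JD : ET ∩ JD = ({ω | ∃ t ∈ T, ω ∈ openConn o t} ∩ {ω | openEdgeCluster ω o ∈ U}) ∩ JD := by
    ext ω
    simp only [hET, hJD, mem_inter_iff, mem_setOf_eq]
    constructor
    · rintro ⟨⟨hE, hUω⟩, hJ, hD⟩
      exact ⟨⟨hE, by rwa [biUnion_eq_openEdgeCluster_of_joined hE hJ] at hUω⟩, hJ, hD⟩
    · rintro ⟨⟨hE, hUω⟩, hJ, hD⟩
      exact ⟨⟨hE, by rwa [biUnion_eq_openEdgeCluster_of_joined hE hJ]⟩, hJ, hD⟩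
  rw [hET_JD] at hfin
  exact hfin

/-- The all-separated event lies in `M`. [folklore] -/
theorem sepAll_subset_M (A T : Finset (Fin n)) (hTA : T ⊆ A) :
    {ω : BondConfig (Fin n) | ∀ x ∈ A, ∀ y ∈ A, x ≠ y → ω ∉ openConn x y} ⊆
      {ω | ∀ y ∈ T, ∀ a ∈ A, y ≠ a → ω ∉ openConn y a} :=
  fun _ hω y hy a ha hya => hω y (hTA hy) a ha hya

/-- **Packing of the singleton sources with an up-set** (ratio form, unconditional): for `T ⊆ A`, `c ∈ A ∖ T`, an up-set
`𝒰`, active sources `T' ⊆ T` with per-source bounds `μ(D_x ∩ {N_c ≥ j+1}) ≤ t_x`, `0 ≤ t_x` (Lean's `x / 0 = 0`):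
`(Σ_{x ∈ T'} μ({o↔x} ∩ {C_x ∈ 𝒰} ∩ D_x ∩ {N_c ≥ j+1}) / t_x) · μ(J_T ∩ D_T) ≤ μ({o ↔ T} ∩ {C_o ∈ 𝒰} ∩ (J_T ∩ D_T))`.
The case `μ(M) = 0` (glued relays) is removed by scaling the weights (`stub_weightContinuity`), as in
`LevelPacking.levelPackingRatio`. [cite: KozmaNitzan2024, Lemmas 1–2 (pp. 5–6); VandenbergHaggstromKahn2005, Thms. 1.3, 1.5] -/
theorem packing_upset (w : Sym2 (Fin n) → unitInterval) (A T : Finset (Fin n)) (hTA : T ⊆ A)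
    (o c : Fin n) (j : ℕ) (hc : c ∈ A \ T) (U : Set (Set (Sym2 (Fin n)))) (hU : IsUpperSet U)
    (T' : Finset (Fin n)) (hT' : T' ⊆ T) (t : Fin n → ℝ) (ht : ∀ x ∈ T', 0 ≤ t x)
    (hq : ∀ x ∈ T', (prodBernoulli w).real ({ω | ∀ s ∈ ({x} : Finset (Fin n)), ∀ u ∈ A \ {x}, ω ∉ openConn s u} ∩
      {ω | j + 1 ≤ (A.filter fun z => ω ∈ openConn c z).card}) ≤ t x) :
    (∑ x ∈ T', (prodBernoulli w).real ((openConn o x : Set (BondConfig (Fin n))) ∩ {ω | openEdgeCluster ω x ∈ U} ∩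
        {ω | ∀ s ∈ ({x} : Finset (Fin n)), ∀ u ∈ A \ {x}, ω ∉ openConn s u} ∩
        {ω | j + 1 ≤ (A.filter fun z => ω ∈ openConn c z).card}) / t x) *
      (prodBernoulli w).real ({ω | ∀ t ∈ T, ∀ t' ∈ T, ω ∈ openConn t t'} ∩
        {ω | ∀ s ∈ T, ∀ u ∈ A \ T, ω ∉ openConn s u}) ≤
    (prodBernoulli w).real (({ω | ∃ t ∈ T, ω ∈ openConn o t} ∩ {ω | openEdgeCluster ω o ∈ U}) ∩
      ({ω | ∀ t ∈ T, ∀ t' ∈ T, ω ∈ openConn t t'} ∩ {ω | ∀ s ∈ T, ∀ u ∈ A \ T, ω ∉ openConn s u})) := by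
  -- notation for the events (all fixed; only the weights move)
  set src : Fin n → Set (BondConfig (Fin n)) := fun x =>
    (openConn o x : Set (BondConfig (Fin n))) ∩ {ω | openEdgeCluster ω x ∈ U} ∩
      {ω | ∀ s ∈ ({x} : Finset (Fin n)), ∀ u ∈ A \ {x}, ω ∉ openConn s u} ∩
      {ω | j + 1 ≤ (A.filter fun z => ω ∈ openConn c z).card} with hsrc
  set DQ : Fin n → Set (BondConfig (Fin n)) := fun x =>
    {ω | ∀ s ∈ ({x} : Finset (Fin n)), ∀ u ∈ A \ {x}, ω ∉ openConn s u} ∩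
      {ω | j + 1 ≤ (A.filter fun z => ω ∈ openConn c z).card} with hDQ
  set JD : Set (BondConfig (Fin n)) := {ω | ∀ t ∈ T, ∀ t' ∈ T, ω ∈ openConn t t'} ∩
    {ω | ∀ s ∈ T, ∀ u ∈ A \ T, ω ∉ openConn s u} with hJD
  set TGT : Set (BondConfig (Fin n)) := ({ω | ∃ t ∈ T, ω ∈ openConn o t} ∩ {ω | openEdgeCluster ω o ∈ U}) ∩
      ({ω | ∀ t ∈ T, ∀ t' ∈ T, ω ∈ openConn t t'} ∩ {ω | ∀ s ∈ T, ∀ u ∈ A \ T, ω ∉ openConn s u}) with hTGT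
  -- sources with `t_x = 0` contribute nothing: restrict to the positive ones
  set T'' := T'.filter fun x => 0 < t x with hT''
  have hT''sub : T'' ⊆ T' := Finset.filter_subset _ _
  have hsum_eq : ∀ (ν : Fin n → ℝ), (∑ x ∈ T', ν x / t x) = ∑ x ∈ T'', ν x / t x := by
    intro ν
    rw [hT'', Finset.sum_filter]
    refine Finset.sum_congr rfl fun x hx => ?_
    by_cases h : 0 < t x
    · rw [if_pos h]
    · have h0 : t x = 0 := le_antisymm (not_lt.1 h) (ht x hx)
      rw [if_neg h, h0, div_zero]
  show (∑ x ∈ T', (prodBernoulli w).real (src x) / t x) * (prodBernoulli w).real JD ≤ (prodBernoulli w).real TGT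
  rw [hsum_eq]
  -- scaled weights `w_k = (1 - 1/(k+1)) • w`, all `< 1`, converging to `w`
  have hcmem : ∀ k : ℕ, ((1 : ℝ) - 1 / ((k : ℝ) + 1)) ∈ unitInterval := by
    intro k
    have hk : (0 : ℝ) < (k : ℝ) + 1 := Nat.cast_add_one_pos k
    have h1 : 1 / ((k : ℝ) + 1) ≤ 1 := by
      rw [div_le_one hk]; linarith [(Nat.cast_nonneg k : (0 : ℝ) ≤ k)]
    have h0 : 0 ≤ 1 / ((k : ℝ) + 1) := by positivity
    exact ⟨by linarith, by linarith⟩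
  set wk : ℕ → Sym2 (Fin n) → unitInterval :=
    fun k e => ⟨(1 - 1 / ((k : ℝ) + 1)) * (w e : ℝ), unitInterval.mul_mem (hcmem k) (w e).2⟩
    with hwk_def
  have hwk_lt : ∀ k e, ((wk k e : unitInterval) : ℝ) < 1 := by
    intro k e
    have hc' : (1 : ℝ) - 1 / ((k : ℝ) + 1) < 1 := by
      have : 0 < 1 / ((k : ℝ) + 1) := by positivity
      linarith
    calc ((wk k e : unitInterval) : ℝ) = (1 - 1 / ((k : ℝ) + 1)) * (w e : ℝ) := rfl
      _ ≤ (1 - 1 / ((k : ℝ) + 1)) := mul_le_of_le_one_right (hcmem k).1 (w e).2.2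
      _ < 1 := hc'
  have hc_lim : Tendsto (fun k : ℕ => (1 : ℝ) - 1 / ((k : ℝ) + 1)) atTop (𝓝 1) := by
    simpa using tendsto_const_nhds.sub (tendsto_one_div_add_atTop_nhds_zero_nat (𝕜 := ℝ))
  have hwk_lim : Tendsto wk atTop (𝓝 w) := by
    refine tendsto_pi_nhds.2 fun e => ?_
    rw [tendsto_subtype_rng]
    have h := hc_lim.mul_const (w e : ℝ)
    rw [one_mul] at h
    exact h
  have hlimE : ∀ E : Set (Set (Sym2 (Fin n))),
      Tendsto (fun k => (prodBernoulli (wk k)).real E) atTop (𝓝 ((prodBernoulli w).real E)) :=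
    fun E => ((stub_weightContinuity n E).tendsto w).comp hwk_lim
  set δ : ℕ → ℝ := fun k => ∑ x ∈ T'',
      |(prodBernoulli (wk k)).real (DQ x) - (prodBernoulli w).real (DQ x)| with hδ_def
  have hδ0 : ∀ k, 0 ≤ δ k := fun k => Finset.sum_nonneg fun x _ => abs_nonneg _
  have hδ_lim : Tendsto δ atTop (𝓝 0) := by
    have h : ∀ x ∈ T'', Tendsto (fun k =>
        |(prodBernoulli (wk k)).real (DQ x) - (prodBernoulli w).real (DQ x)|) atTop (𝓝 0) := by
      intro x _
      simpa using (tendsto_sub_nhds_zero_iff.2 (hlimE (DQ x))).abs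
    simpa [hδ_def] using tendsto_finsetSum T'' h
  have hk : ∀ k, (∑ x ∈ T'', (prodBernoulli (wk k)).real (src x) / (t x + δ k)) *
      (prodBernoulli (wk k)).real JD ≤ (prodBernoulli (wk k)).real TGT := by
    intro k
    refine packing_upset_of_pos (wk k) A T hTA o c j hc U hU T'' (hT''sub.trans hT') (fun x => t x + δ k)
      (fun x hx => by linarith [hδ0 k, ht x (hT''sub hx)]) ?_ ?_
    · intro x hx
      have h1 := hq x (hT''sub hx)
      have h2 : |(prodBernoulli (wk k)).real (DQ x) - (prodBernoulli w).real (DQ x)| ≤ δ k :=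
        Finset.single_le_sum (f := fun x => |(prodBernoulli (wk k)).real (DQ x) - (prodBernoulli w).real (DQ x)|)
          (fun x _ => abs_nonneg _) hx
      have h3 := le_abs_self ((prodBernoulli (wk k)).real (DQ x) - (prodBernoulli w).real (DQ x))
      show (prodBernoulli (wk k)).real (DQ x) ≤ t x + δ k
      have h1' : (prodBernoulli w).real (DQ x) ≤ t x := h1
      linarith
    · exact lt_of_lt_of_le (singleFinger_pairSep_real_pos (wk k) (hwk_lt k) A)
        (measureReal_mono (sepAll_subset_M A T hTA))
  have hlimL : Tendsto (fun k => (∑ x ∈ T'', (prodBernoulli (wk k)).real (src x) / (t x + δ k)) *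
      (prodBernoulli (wk k)).real JD) atTop
      (𝓝 ((∑ x ∈ T'', (prodBernoulli w).real (src x) / t x) * (prodBernoulli w).real JD)) := by
    refine (tendsto_finsetSum T'' fun x hx => ?_).mul (hlimE _)
    have htx : 0 < t x := (Finset.mem_filter.1 hx).2
    have hden : Tendsto (fun k => t x + δ k) atTop (𝓝 (t x)) := by
      simpa using tendsto_const_nhds.add hδ_lim
    exact (hlimE _).div hden htx.ne'
  exact le_of_tendsto_of_tendsto' hlimL (hlimE _) hk


end UTSingletons

end Summit.CriticalPhenomena.PercolationContinuityZ3.Theorems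

end
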